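import Literature.AlgebraicGeometry.Deformation.CurvilinearSmoothness
import HarnessLib

/-!
# Group functors of Artin rings: the T¹-lifting property is the lifting of the kernels `K_G(A_n)`
# ([FM98, Lemma 7.15]); for `h_R` the kernels always lift ([FM98, Lemma 7.16]); hence a PRO-REPRESENTABLE group functor
# over a field of characteristic zero is a formal power series ring ([FM98, Thm. 7.19] in the case of Example 7.1) —
# AS PRINTED

Family `hodge` (computation cell `pub-hsemireg`, LIT-W seat «Kawamata ∕ Ran T¹-lifting as printed»), layer
`Literature/AlgebraicGeometry/Deformation`, on top of `CurvilinearSmoothness.lean` (Kawamata's T¹-lifting theorem for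
`h_R`, `powerSeries_ideal_eq_bot_of_t1Lifting`). THEOREMS only (no definition, no named fact, no `sorry`). A GROUP
FUNCTOR OF ARTIN RINGS ([FantechiManetti1998ObstructionCalculus, §7, p. 569]: «By a group functor of Artin rings we
shall mean a functor `G` from `Art_k` to the category of groups such that the associated functor from `Art_k` to `Set_*`
which forgets the group structure is a functor of Artin rings in the sense of Definition 2.1.»; `Set_*` = the category of
pointed sets, p. 543 — the tree's `ArtinFunctor` does not impose `F(k) = *`) is handled WITHOUT a new structure: as
a functor of Artin rings `F : ArtinFunctor k` (the tree's, `T1Lifting.lean`) together with a group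
structure on every `F(X)` (instance hypotheses `[∀ X, Group (F.obj X)]`) for which every `F(φ)` is multiplicative
(hypothesis `hmul`; units and inverses are then preserved, `MonoidHom.mk'`). The kernel
`K_G(A_n) = ker(G(B_n) → G(A_n))` (p. 574, `B_n = A_n ⊗_k k[ε] = A_n[ε]` = the tree's `T1Lifting.B k n`,
`G(B_n) → G(A_n)` induced by `bA : x ↦ t, y ↦ 0`) is written as the condition `F.map bA g = 1`.

## Sources, verbatim ([FantechiManetti1998ObstructionCalculus], J. Algebra 202 (1998), §7 «Group and automorphism
## functors», store text pp. 569–575)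

* EXAMPLE 7.1 (p. 569): «If `R` is the local ring at the unit element of a group scheme [Mum, Sect. 11], then `G = h_R`
  is a group functor satisfying conditions (H1), (H2), and (H4).»
* LEMMA 7.15 (p. 574): «Let `G` be a Gdt group functor. Then the T¹-lifting property holds for `G` if and only if the
  natural map `K_G(A_{n+1}) → K_G(A_n)` is surjective for every `n`. Proof. Note first that `b_n : B_n → A_n` has a
  splitting given by `t ↦ x`. Note also that `B_n = A_n ⊗_k k[ε]`, hence `K_G(A_n) = ker(G(B_n) → G(A_n))`. Choose an
  element `(a', b)` in `G(A_{n+1}) ×_{G(A_n)} G(B_n)`; we want to prove that `(a', b)` lifts to `G(B_{n+1})`. Using the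
  section of `b_{n+1}` we can find `b̃' ∈ G(B_{n+1})` mapping to `a'`. Let `b̄'` be the image of `b̃'` in `G(B_n)`. As `b`
  and `b̄'` have the same image in `G(A_n)`, there exists an element `g ∈ K_G(A_n)` such that `b = g b̄'`. By assumption
  `g` can be lifted to `g' ∈ K_G(B_n)` [so printed; `K_G(A_{n+1})`]; it is then easy to verify that `b' = g' b̃'` is the
  required lifting.» (`K_F(A) := ker(F(A ⊗_k k[ε]) → F(A))`, p. 573.)
* LEMMA 7.16 (p. 574): «If `H = h_R` is a prorepresentable functor then `K_H(A) = t_H ⊗ A`; in particular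
  `K_H(B) → K_H(A)` is surjective whenever `B → A` is. Proof. For every `a ∈ R` let `ā ∈ k` be its class in the residue
  field. The elements of `K_H(A)` are exactly the morphisms `R → A ⊗_k k[ε]` of the form `a → ā + ε f(a)` where
  `f ∈ Der_k(R, A)` and the `R`-module structure on `A` is induced by the projection `R → k`. Hence
  `K_H(A) = Der_k(R, A) = Hom_k(Ω_{R/k}, A) = t_H ⊗ A`.»
* THEOREM 7.19 (p. 575): «Let `G` be a Gdt group functor over a field `k` of characteristic `0`. Then `G` is smooth.
  Proof. By Proposition 7.3 and Corollary 6.15 it is sufficient to show that `G` has the T¹-lifting property. By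
  Lemma 7.15 this is equivalent to the surjectivity of `K_G(A_n) → K_G(A_{n−1})` for every `n ≥ 2`; this is an immediate
  consequence of Lemma 7.18 (ii).» — LEMMA 7.18 (ii) (p. 574): «for every small extension `B → A` the map
  `K_G(B) → K_G(A)` is onto», proved through the Factorization Theorem 6.2; for `G = h_R` PRO-REPRESENTABLE it is
  Lemma 7.16, and Cor. 6.15 for `h_R` is Kawamata's T¹-lifting theorem (the tree's `powerSeries_ideal_eq_bot_of_t1Lifting`,
  via [FM98, Lemma 5.6]) — so in the pro-representable case the printed proof closes without §6.
* Intro, p. 542: «as a consequence we derive that every Gdt group functor is smooth in characteristic zero» (the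
  statement [Mum, Sect. 11] proves for group schemes: Cartier's theorem).

## What this file proves

* `T1Lifting.bA_comp_inlAlgHom`, `T1Lifting.β_comp_inlAlgHom`, `T1Lifting.bA_comp_β` — «`b_n : B_n → A_n` has a
  splitting given by `t ↦ x`» (the inclusion `A_n → A_n[ε]`, `TrivSqZeroExt.inlAlgHom`), compatible with `β` and `i`.
* `ArtinFunctor.t1Lifting_of_kernel_lifting` (LEMMA 7.15 «if», the printed proof line by line),
  `ArtinFunctor.kernel_lifting_of_t1Lifting` («only if»), `ArtinFunctor.t1Lifting_iff_kernel_lifting` (LEMMA 7.15) —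
  for ANY functor of Artin rings with functorial group structures (the «Gdt» hypothesis of the printed lemma is not
  used by its proof and not assumed).
* For PRESENTED `R = k[[x_1, …, x_n]]/I` (`h_R = ArtinFunctor.points (P ⧸ I)`): `T1Lifting.algHom_X_eq_zero_artA_zero`
  (`h_R(A_0)` is one point), `points_one_apply_mk_X` (under a functorial group structure the unit of `h_R(X)` is the
  trivial point — «the `R`-module structure on `A` is induced by the projection `R → k`»), `points_map_bA_eq_one_iff`
  (`K_H(A_m)` = the points `R → A_m[ε]` with values on the variables in `ε A_m`), and LEMMA 7.16's lifting
  `points_kernel_lifting` (`I ⊆ 𝔪²`; group-free form: such points lift along `β : B_{m+1} → B_m`, since `ε² = 0` kills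
  `𝔪_P² ⊇ I`).
* `powerSeries_ideal_eq_bot_of_groupFunctor` — THEOREM 7.19 IN THE PRO-REPRESENTABLE CASE (Example 7.1's situation,
  abstractly): `char k = 0`, `R = k[[x_1, …, x_n]]/I`, `I ⊆ 𝔪²`, `h_R` the underlying functor of a group functor of
  Artin rings ⇒ `I = 0` («`G` is smooth»: `R` is a formal power series ring).

HONEST SCOPE. (1) Theorem 7.19 AS PRINTED (every Gdt group functor, char 0) is NOT typed: its general case rests on
Lemma 7.18 and the Factorization Theorem 6.2 (and on Prop. 7.3 / Cor. 6.15 for functors without a hull), none of which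
is in the tree; only the pro-representable case is, where Lemma 7.16 replaces Lemma 7.18 (ii). (2) Lemma 7.16's
identification `K_H(A) = Der_k(R, A) = t_H ⊗ A` is used only through its consequence (the lifting); no module of
derivations is typed. (3) `R` is PRESENTED as `P/I`, `I ⊆ 𝔪_P²` (Cohen not formalised, as in `CurvilinearSmoothness.lean`);
no group scheme, no `Aut_X` (Example 7.2), no [Mum, Sect. 11] statement about algebraic groups is instantiated or
claimed — the theorem speaks about an abstract functorial group structure on `h_R`. (4) Nothing here concerns any
object of the cell; nothing says HC ∕ HC_CM ∕ HC_AV is proved.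

## References

* B. Fantechi, M. Manetti, *Obstruction calculus for functors of Artin rings, I*, J. Algebra 202 (1998) 541–576: §7,
  Example 7.1 (p. 569), Lemma 7.15, Lemma 7.16 (p. 574), Lemma 7.18, Theorem 7.19 (p. 575); Lemma 5.6 (p. 561),
  Cor. 6.15 (p. 569). [FantechiManetti1998ObstructionCalculus]
* B. Fantechi, M. Manetti, *On the T¹-lifting theorem*, J. Algebraic Geom. 8 (1999) 31–39: Def. 1.1 (the maps
  `B_{n+1} → B_n`, `B_n → A_n`). [FantechiManetti1999T1Lifting]
-/

universe u

open MvPolynomial TrivSqZeroExt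

namespace Literature.AlgebraicGeometry.Deformation

section GroupFunctors

namespace T1Lifting

variable (k : Type u) [Field k]

/-- The splitting `t ↦ x` of `b_n : B_n → A_n` ([FantechiManetti1998ObstructionCalculus, proof of Lemma 7.15]: «Note
first that `b_n : B_n → A_n` has a splitting given by `t ↦ x`»): the inclusion `A_n → A_n[ε] = B_n` is a section of `bA`.
[cite: FantechiManetti1998ObstructionCalculus, Lemma 7.15] -/
theorem bA_comp_inlAlgHom (n : ℕ) : (bA k n).comp (inlAlgHom k (A k n) (A k n)) = AlgHom.id k (A k n) :=
  AlgHom.ext fun a => by simp [bA]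

/-- The splittings are compatible with `β : B_{n+1} → B_n` and `i : A_{n+1} → A_n`.
[cite: FantechiManetti1998ObstructionCalculus, Lemma 7.15] -/
theorem β_comp_inlAlgHom (n : ℕ) :
    (β k n).comp (inlAlgHom k (A k (n + 1)) (A k (n + 1))) = (inlAlgHom k (A k n) (A k n)).comp (i k n) :=
  AlgHom.ext fun a => by
    refine TrivSqZeroExt.ext ?_ ?_
    · simp
    · simp

/-- `bA ∘ β = i ∘ bA : B_{n+1} → A_n`. [cite: FantechiManetti1999T1Lifting, Def. 1.1] -/
theorem bA_comp_β (n : ℕ) : (bA k n).comp (β k n) = (i k n).comp (bA k (n + 1)) :=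
  AlgHom.ext fun z => by simp

end T1Lifting

variable {k : Type u} [Field k]

/-- **[FantechiManetti1998ObstructionCalculus, LEMMA 7.15], «if»** (p. 574: «Let `G` be a Gdt group functor. Then the
T¹-lifting property holds for `G` if and only if the natural map `K_G(A_{n+1}) → K_G(A_n)` is surjective for every
`n`.», with «`B_n = A_n ⊗_k k[ε]`, hence `K_G(A_n) = ker(G(B_n) → G(A_n))`»; printed proof: «Choose an element
`(a', b)` in `G(A_{n+1}) ×_{G(A_n)} G(B_n)`; we want to prove that `(a', b)` lifts to `G(B_{n+1})`. Using the section of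
`b_{n+1}` we can find `b̃' ∈ G(B_{n+1})` mapping to `a'`. Let `b̄'` be the image of `b̃'` in `G(B_n)`. As `b` and `b̄'` have
the same image in `G(A_n)`, there exists an element `g ∈ K_G(A_n)` such that `b = g b̄'`. By assumption `g` can be lifted
to `g' ∈ K_G(B_n)` [sic: `K_G(A_{n+1})`]; it is then easy to verify that `b' = g' b̃'` is the required lifting.»). A GROUP
FUNCTOR OF ARTIN RINGS (p. 569: «a functor `G` from `Art_k` to the category of groups such that the associated functor
from `Art_k` to `Set_*` which forgets the group structure is a functor of Artin rings») is given here as a functor of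
Artin rings `F` with a group structure on every `F(X)` such that every `F(φ)` is multiplicative; no (H1)/(H2) («Gdt») is used
in this direction. [cite: FantechiManetti1998ObstructionCalculus, Lemma 7.15] -/
theorem ArtinFunctor.t1Lifting_of_kernel_lifting (F : ArtinFunctor.{u} k) [∀ X : ArtAlg.{u} k, Group (F.obj X)]
    (hmul : ∀ ⦃X Y : ArtAlg.{u} k⦄ (φ : X →ₐ[k] Y) (a b : F.obj X), F.map φ (a * b) = F.map φ a * F.map φ b)
    (hK : ∀ (n : ℕ) (g : F.obj (T1Lifting.artB k n)),
      F.map (R := T1Lifting.artB k n) (S := T1Lifting.artA k n) (T1Lifting.bA k n) g = 1 →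
      ∃ g' : F.obj (T1Lifting.artB k (n + 1)),
        F.map (R := T1Lifting.artB k (n + 1)) (S := T1Lifting.artA k (n + 1)) (T1Lifting.bA k (n + 1)) g' = 1 ∧
        F.map (R := T1Lifting.artB k (n + 1)) (S := T1Lifting.artB k n) (T1Lifting.β k n) g' = g) :
    F.T1Lifting := by
  intro n b a hab
  -- the maps as monoid homomorphisms
  have hone : ∀ ⦃X Y : ArtAlg.{u} k⦄ (φ : X →ₐ[k] Y), F.map φ 1 = 1 := fun X Y φ =>
    (MonoidHom.mk' (F.map φ) (hmul φ)).map_one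
  have hinv : ∀ ⦃X Y : ArtAlg.{u} k⦄ (φ : X →ₐ[k] Y) (a : F.obj X), F.map φ a⁻¹ = (F.map φ a)⁻¹ := fun X Y φ a =>
    (MonoidHom.mk' (F.map φ) (hmul φ)).map_inv a
  -- `b̃' = G(section)(a')` and its image `b̄'` in `G(B_n)`
  set bt := F.map (R := T1Lifting.artA k (n + 1)) (S := T1Lifting.artB k (n + 1))
    (inlAlgHom k (T1Lifting.A k (n + 1)) (T1Lifting.A k (n + 1))) a with hbt
  set bb := F.map (R := T1Lifting.artB k (n + 1)) (S := T1Lifting.artB k n) (T1Lifting.β k n) bt with hbb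
  have hbt_A : F.map (R := T1Lifting.artB k (n + 1)) (S := T1Lifting.artA k (n + 1)) (T1Lifting.bA k (n + 1)) bt = a := by
    rw [hbt, ← F.map_comp (R := T1Lifting.artA k (n + 1)) (S := T1Lifting.artB k (n + 1)) (T := T1Lifting.artA k (n + 1)),
      T1Lifting.bA_comp_inlAlgHom, F.map_id]
  have hbb_eq : bb = F.map (R := T1Lifting.artA k n) (S := T1Lifting.artB k n) (inlAlgHom k (T1Lifting.A k n) (T1Lifting.A k n))
      (F.map (R := T1Lifting.artB k n) (S := T1Lifting.artA k n) (T1Lifting.bA k n) b) := by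
    rw [hbb, hbt, ← F.map_comp (R := T1Lifting.artA k (n + 1)) (S := T1Lifting.artB k (n + 1)) (T := T1Lifting.artB k n),
      T1Lifting.β_comp_inlAlgHom,
      F.map_comp (R := T1Lifting.artA k (n + 1)) (S := T1Lifting.artA k n) (T := T1Lifting.artB k n), ← hab]
  have hbb_A : F.map (R := T1Lifting.artB k n) (S := T1Lifting.artA k n) (T1Lifting.bA k n) bb =
      F.map (R := T1Lifting.artB k n) (S := T1Lifting.artA k n) (T1Lifting.bA k n) b := by
    rw [hbb_eq, ← F.map_comp (R := T1Lifting.artA k n) (S := T1Lifting.artB k n) (T := T1Lifting.artA k n),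
      T1Lifting.bA_comp_inlAlgHom, F.map_id]
  -- `g = b b̄'⁻¹ ∈ K_G(A_n)` and its lift `g'`
  obtain ⟨g', hg'1, hg'2⟩ := hK n (b * bb⁻¹) (by rw [hmul, hinv, hbb_A, mul_inv_cancel])
  refine ⟨g' * bt, ?_, ?_⟩
  · rw [hmul, hg'2, ← hbb, inv_mul_cancel_right]
  · rw [hmul, hg'1, hbt_A, one_mul]

/-- **[FantechiManetti1998ObstructionCalculus, LEMMA 7.15], «only if»**: conversely the T¹-lifting property gives the
surjectivity of every `K_G(A_{n+1}) → K_G(A_n)` (lift the compatible pair `(g, 1)`; the lift lies in the kernel).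
[cite: FantechiManetti1998ObstructionCalculus, Lemma 7.15] -/
theorem ArtinFunctor.kernel_lifting_of_t1Lifting (F : ArtinFunctor.{u} k) [∀ X : ArtAlg.{u} k, Group (F.obj X)]
    (hmul : ∀ ⦃X Y : ArtAlg.{u} k⦄ (φ : X →ₐ[k] Y) (a b : F.obj X), F.map φ (a * b) = F.map φ a * F.map φ b)
    (hT : F.T1Lifting) (n : ℕ) (g : F.obj (T1Lifting.artB k n))
    (hg : F.map (R := T1Lifting.artB k n) (S := T1Lifting.artA k n) (T1Lifting.bA k n) g = 1) :
    ∃ g' : F.obj (T1Lifting.artB k (n + 1)),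
      F.map (R := T1Lifting.artB k (n + 1)) (S := T1Lifting.artA k (n + 1)) (T1Lifting.bA k (n + 1)) g' = 1 ∧
      F.map (R := T1Lifting.artB k (n + 1)) (S := T1Lifting.artB k n) (T1Lifting.β k n) g' = g := by
  have hone : ∀ ⦃X Y : ArtAlg.{u} k⦄ (φ : X →ₐ[k] Y), F.map φ 1 = 1 := fun X Y φ =>
    (MonoidHom.mk' (F.map φ) (hmul φ)).map_one
  obtain ⟨g', h1, h2⟩ := hT n g 1 (by rw [hg, hone])
  exact ⟨g', h2, h1⟩

/-- **[FantechiManetti1998ObstructionCalculus, LEMMA 7.15] AS PRINTED (the equivalence)**: for a group functor of Artin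
rings, the T¹-lifting property ([FantechiManetti1999T1Lifting, Def. 1.1] = [FantechiManetti1998ObstructionCalculus,
Def. 6.13]) holds iff `K_G(A_{n+1}) → K_G(A_n)` is onto for every `n`, `K_G(A_n) = ker(G(B_n) → G(A_n))`.
[cite: FantechiManetti1998ObstructionCalculus, Lemma 7.15] -/
theorem ArtinFunctor.t1Lifting_iff_kernel_lifting (F : ArtinFunctor.{u} k) [∀ X : ArtAlg.{u} k, Group (F.obj X)]
    (hmul : ∀ ⦃X Y : ArtAlg.{u} k⦄ (φ : X →ₐ[k] Y) (a b : F.obj X), F.map φ (a * b) = F.map φ a * F.map φ b) :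
    F.T1Lifting ↔ ∀ (n : ℕ) (g : F.obj (T1Lifting.artB k n)),
      F.map (R := T1Lifting.artB k n) (S := T1Lifting.artA k n) (T1Lifting.bA k n) g = 1 →
      ∃ g' : F.obj (T1Lifting.artB k (n + 1)),
        F.map (R := T1Lifting.artB k (n + 1)) (S := T1Lifting.artA k (n + 1)) (T1Lifting.bA k (n + 1)) g' = 1 ∧
        F.map (R := T1Lifting.artB k (n + 1)) (S := T1Lifting.artB k n) (T1Lifting.β k n) g' = g :=
  ⟨fun hT n g hg => F.kernel_lifting_of_t1Lifting hmul hT n g hg, F.t1Lifting_of_kernel_lifting hmul⟩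

/-! ### [FantechiManetti1998ObstructionCalculus, Lemma 7.16] for presented `R = k[[x_1, …, x_n]]/I`, `I ⊆ 𝔪²`, and
Theorem 7.19 in the pro-representable case (Example 7.1) -/

section ProRepresentable

variable (k : Type u) [Field k]

/-- In `A_0 = k[t]/(t) = k` the maximal ideal is zero: every `k`-algebra map `k[[x_1, …, x_n]] → A_0` kills the variables
(so `h_R(A_0)` is a single point, print's `F(k) = {pt}`). [cite: FantechiManetti1999T1Lifting, p. 1] -/
theorem T1Lifting.algHom_X_eq_zero_artA_zero {n : ℕ} (Ψ : MvPowerSeries (Fin n) k →ₐ[k] T1Lifting.A k 0) (i : Fin n) :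
    Ψ (MvPowerSeries.X i) = 0 := by
  have hmem := T1Lifting.algHom_X_mem_maximalIdeal k (T1Lifting.artA k 0) Ψ i
  obtain ⟨b, hb⟩ := T1Lifting.exists_eq_t_mul_of_not_isUnit k 0 ((IsLocalRing.mem_maximalIdeal _).1 hmem)
  rw [hb, show T1Lifting.t k 0 = 0 from by simpa using T1Lifting.t_pow_succ k 0, zero_mul]

/-- In an object of `Art_k` the maximal ideal is nilpotent: `𝔪_S^M = 0` for some `M ≥ 1`. [folklore] -/
private theorem T1Lifting.exists_one_le_maximalIdeal_pow_eq_bot' (S : ArtAlg.{u} k) :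
    ∃ M : ℕ, 1 ≤ M ∧ IsLocalRing.maximalIdeal S ^ M = ⊥ := by
  obtain ⟨M, hM⟩ := IsArtinianRing.isNilpotent_jacobson_bot (R := S)
  rw [IsLocalRing.jacobson_eq_maximalIdeal ⊥ bot_ne_top] at hM
  refine ⟨M + 1, Nat.le_add_left 1 M, le_bot_iff.1 ?_⟩
  calc IsLocalRing.maximalIdeal S ^ (M + 1) ≤ IsLocalRing.maximalIdeal S ^ M := Ideal.pow_le_pow_right (Nat.le_succ M)
    _ = ⊥ := hM

/-- THE UNIT OF A GROUP STRUCTURE ON `h_R` IS THE TRIVIAL POINT ([FantechiManetti1998ObstructionCalculus, proof of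
Lemma 7.16]: «the `R`-module structure on `A` is induced by the projection `R → k`»): if the functor of points of
`R = k[[x_1, …, x_n]]/I` carries a group structure for which every `h_R(φ)` is multiplicative, then the unit
`1 ∈ h_R(X)` kills every variable, for every `X ∈ Art_k` — it is the image of the unique point of `h_R(A_0)`, `A_0 = k`,
under `A_0 → X`. [cite: FantechiManetti1998ObstructionCalculus, Lemma 7.16] -/
theorem points_one_apply_mk_X {n : ℕ} (I : Ideal (MvPowerSeries (Fin n) k))
    [∀ X : ArtAlg.{u} k, Group ((ArtinFunctor.points (k := k) (MvPowerSeries (Fin n) k ⧸ I)).obj X)]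
    (hmul : ∀ ⦃X Y : ArtAlg.{u} k⦄ (φ : X →ₐ[k] Y)
      (a b : (ArtinFunctor.points (k := k) (MvPowerSeries (Fin n) k ⧸ I)).obj X),
      (ArtinFunctor.points (k := k) (MvPowerSeries (Fin n) k ⧸ I)).map φ (a * b) =
        (ArtinFunctor.points (k := k) (MvPowerSeries (Fin n) k ⧸ I)).map φ a *
          (ArtinFunctor.points (k := k) (MvPowerSeries (Fin n) k ⧸ I)).map φ b)
    (X : ArtAlg.{u} k) (i : Fin n) :
    (show (MvPowerSeries (Fin n) k ⧸ I) →ₐ[k] X from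
      (1 : (ArtinFunctor.points (k := k) (MvPowerSeries (Fin n) k ⧸ I)).obj X))
      (Ideal.Quotient.mk I (MvPowerSeries.X i)) = 0 := by
  have hone : ∀ ⦃X Y : ArtAlg.{u} k⦄ (φ : X →ₐ[k] Y),
      (ArtinFunctor.points (k := k) (MvPowerSeries (Fin n) k ⧸ I)).map φ 1 = 1 := fun X Y φ =>
    (MonoidHom.mk' ((ArtinFunctor.points (k := k) (MvPowerSeries (Fin n) k ⧸ I)).map φ) (hmul φ)).map_one
  set ι : T1Lifting.artA k 0 →ₐ[k] X := (Algebra.ofId k X).comp (T1Lifting.augA k 0) with hι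
  -- the unit of `h_R(X)` is the image of the unit of `h_R(A_0)`, which kills the variables
  set e₀ : (MvPowerSeries (Fin n) k ⧸ I) →ₐ[k] T1Lifting.A k 0 :=
    (show (MvPowerSeries (Fin n) k ⧸ I) →ₐ[k] T1Lifting.A k 0 from
      (1 : (ArtinFunctor.points (k := k) (MvPowerSeries (Fin n) k ⧸ I)).obj (T1Lifting.artA k 0))) with he₀
  have h1 : (show (MvPowerSeries (Fin n) k ⧸ I) →ₐ[k] X from
      (1 : (ArtinFunctor.points (k := k) (MvPowerSeries (Fin n) k ⧸ I)).obj X)) = ι.comp e₀ := by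
    rw [he₀]
    exact (hone (X := T1Lifting.artA k 0) (Y := X) ι).symm
  have h0 : e₀ (Ideal.Quotient.mk I (MvPowerSeries.X i)) = 0 := by
    have := T1Lifting.algHom_X_eq_zero_artA_zero k (e₀.comp (Ideal.Quotient.mkₐ k I)) i
    rwa [AlgHom.comp_apply, Ideal.Quotient.mkₐ_eq_mk] at this
  rw [h1, AlgHom.comp_apply, h0, map_zero]

/-- THE KERNEL `K_H(A_n)` FOR `H = h_R` ([FantechiManetti1998ObstructionCalculus, Lemma 7.16]: «The elements of `K_H(A)`
are exactly the morphisms `R → A ⊗_k k[ε]` of the form `a → ā + ε f(a)` where `f ∈ Der_k(R, A)`»): under a group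
structure on `h_R`, `R = k[[x_1, …, x_n]]/I`, a point `g : R → B_n = A_n[ε]` maps to `1 ∈ h_R(A_n)` under `bA` iff its
values on the variables have no `A_n`-component (lie in `ε A_n`).
[cite: FantechiManetti1998ObstructionCalculus, Lemma 7.16] -/
theorem points_map_bA_eq_one_iff {n : ℕ} (I : Ideal (MvPowerSeries (Fin n) k))
    [∀ X : ArtAlg.{u} k, Group ((ArtinFunctor.points (k := k) (MvPowerSeries (Fin n) k ⧸ I)).obj X)]
    (hmul : ∀ ⦃X Y : ArtAlg.{u} k⦄ (φ : X →ₐ[k] Y)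
      (a b : (ArtinFunctor.points (k := k) (MvPowerSeries (Fin n) k ⧸ I)).obj X),
      (ArtinFunctor.points (k := k) (MvPowerSeries (Fin n) k ⧸ I)).map φ (a * b) =
        (ArtinFunctor.points (k := k) (MvPowerSeries (Fin n) k ⧸ I)).map φ a *
          (ArtinFunctor.points (k := k) (MvPowerSeries (Fin n) k ⧸ I)).map φ b)
    (m : ℕ) (g : (MvPowerSeries (Fin n) k ⧸ I) →ₐ[k] T1Lifting.B k m) :
    (ArtinFunctor.points (k := k) (MvPowerSeries (Fin n) k ⧸ I)).map (R := T1Lifting.artB k m)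
        (S := T1Lifting.artA k m) (T1Lifting.bA k m) g = 1 ↔
      ∀ i, (g (Ideal.Quotient.mk I (MvPowerSeries.X i))).fst = 0 := by
  have key : (ArtinFunctor.points (k := k) (MvPowerSeries (Fin n) k ⧸ I)).map (R := T1Lifting.artB k m)
        (S := T1Lifting.artA k m) (T1Lifting.bA k m) g =
      (show (MvPowerSeries (Fin n) k ⧸ I) →ₐ[k] T1Lifting.A k m from (T1Lifting.bA k m).comp g) := rfl
  constructor
  · intro h i
    have h' : (T1Lifting.bA k m).comp g = (show (MvPowerSeries (Fin n) k ⧸ I) →ₐ[k] T1Lifting.A k m from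
        (1 : (ArtinFunctor.points (k := k) (MvPowerSeries (Fin n) k ⧸ I)).obj (T1Lifting.artA k m))) := by
      rw [← h]
      rfl
    have := AlgHom.congr_fun h' (Ideal.Quotient.mk I (MvPowerSeries.X i))
    rwa [AlgHom.comp_apply, T1Lifting.bA_apply, points_one_apply_mk_X k I hmul] at this
  · intro h
    rw [key]
    change (T1Lifting.bA k m).comp g = (show (MvPowerSeries (Fin n) k ⧸ I) →ₐ[k] T1Lifting.A k m from
        (1 : (ArtinFunctor.points (k := k) (MvPowerSeries (Fin n) k ⧸ I)).obj (T1Lifting.artA k m)))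
    refine Ideal.Quotient.algHom_ext k (T1Lifting.mvPowerSeries_algHom_ext k (T1Lifting.artA k m) _ _ fun i => ?_)
    rw [AlgHom.comp_apply, AlgHom.comp_apply, Ideal.Quotient.mkₐ_eq_mk, T1Lifting.bA_apply, h i, AlgHom.comp_apply,
      Ideal.Quotient.mkₐ_eq_mk, points_one_apply_mk_X k I hmul]

/-- **[FantechiManetti1998ObstructionCalculus, LEMMA 7.16] (the lifting), for presented `R = k[[x_1, …, x_n]]/I`,
`I ⊆ 𝔪²`** (p. 574: «If `H = h_R` is a prorepresentable functor then `K_H(A) = t_H ⊗ A`; in particular `K_H(B) → K_H(A)`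
is surjective whenever `B → A` is.»; proof: «`K_H(A) = Der_k(R, A) = Hom_k(Ω_{R/k}, A) = t_H ⊗ A`»), in the group-free
form used: a point `g : R → B_m = A_m[ε]` whose values on the variables lie in `ε A_m` lifts along `β : B_{m+1} → B_m` to
a point of the same kind — choose lifts `d̃_i` of the `ε`-components (`i : A_{m+1} → A_m` is onto), send `x_i ↦ ε d̃_i`
(`T1Lifting.exists_algHom_of_pow_eq_bot`); this kills `𝔪_P² ⊇ I` since `ε² = 0`.
[cite: FantechiManetti1998ObstructionCalculus, Lemma 7.16] -/
theorem points_kernel_lifting {n : ℕ} (I : Ideal (MvPowerSeries (Fin n) k))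
    (hI : I ≤ (IsLocalRing.maximalIdeal (MvPowerSeries (Fin n) k)) ^ 2) (m : ℕ)
    (g : (MvPowerSeries (Fin n) k ⧸ I) →ₐ[k] T1Lifting.B k m)
    (hg : ∀ i, (g (Ideal.Quotient.mk I (MvPowerSeries.X i))).fst = 0) :
    ∃ g' : (MvPowerSeries (Fin n) k ⧸ I) →ₐ[k] T1Lifting.B k (m + 1),
      (∀ i, (g' (Ideal.Quotient.mk I (MvPowerSeries.X i))).fst = 0) ∧ (T1Lifting.β k m).comp g' = g := by
  classical
  -- lifts of the `ε`-components
  choose d hd using fun i => T1Lifting.i_surjective k m ((g (Ideal.Quotient.mk I (MvPowerSeries.X i))).snd)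
  set v : Fin n → T1Lifting.B k (m + 1) := fun i => inr (d i) with hv
  have hvm : ∀ i, v i ∈ IsLocalRing.maximalIdeal (T1Lifting.B k (m + 1)) := fun i => by
    rw [IsLocalRing.mem_maximalIdeal, mem_nonunits_iff, isUnit_iff_isUnit_fst, hv]
    simp
  obtain ⟨M, hM1, hM⟩ := T1Lifting.exists_one_le_maximalIdeal_pow_eq_bot' k (T1Lifting.artB k (m + 1))
  obtain ⟨G, -, hG⟩ := T1Lifting.exists_algHom_of_pow_eq_bot k
    (IsLocalRing.maximalIdeal (T1Lifting.B k (m + 1))) M hM1 hM v hvm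
  -- `G` has no `A`-component on `𝔪_P`, hence kills `𝔪_P²`
  have hfst : ∀ u ∈ IsLocalRing.maximalIdeal (MvPowerSeries (Fin n) k), (G u).fst = 0 := by
    intro u hu
    have hΦ := T1Lifting.algHom_eq_zero_of_coeff_eq_zero k ((T1Lifting.bA k (m + 1)).comp G) ⊥ 1 (by simp)
      (fun i => by rw [AlgHom.comp_apply, hG, T1Lifting.bA_apply, hv, fst_inr, Submodule.mem_bot]) u
      (fun e he => by
        have he0 : e = 0 := (Finsupp.degree_eq_zero_iff e).1 (by omega)
        subst he0
        rw [MvPowerSeries.coeff_zero_eq_constantCoeff_apply]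
        have hu' := (IsLocalRing.mem_maximalIdeal _).1 hu
        rw [mem_nonunits_iff, MvPowerSeries.isUnit_iff_constantCoeff, isUnit_iff_ne_zero, not_not] at hu'
        exact hu')
    simpa using hΦ
  have hsq : ∀ f ∈ (IsLocalRing.maximalIdeal (MvPowerSeries (Fin n) k)) ^ 2, G f = 0 := by
    intro f hf
    rw [pow_two] at hf
    refine Submodule.mul_induction_on hf (fun u hu w hw => ?_) (fun x y hx hy => by rw [map_add, hx, hy, add_zero])
    rw [map_mul, ← inl_fst_add_inr_snd_eq (G u), ← inl_fst_add_inr_snd_eq (G w), hfst u hu, hfst w hw, inl_zero,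
      zero_add, zero_add, inr_mul_inr]
  have hGI : ∀ f ∈ I, G f = 0 := fun f hf => hsq f (hI hf)
  refine ⟨Ideal.Quotient.liftₐ I G hGI, fun i => ?_, ?_⟩
  · rw [← Ideal.Quotient.mkₐ_eq_mk k, ← AlgHom.comp_apply, Ideal.Quotient.liftₐ_comp, hG, hv, fst_inr]
  · refine Ideal.Quotient.algHom_ext k (T1Lifting.mvPowerSeries_algHom_ext k (T1Lifting.artB k m) _ _ fun i => ?_)
    rw [AlgHom.comp_assoc, Ideal.Quotient.liftₐ_comp, AlgHom.comp_apply, hG, AlgHom.comp_apply,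
      Ideal.Quotient.mkₐ_eq_mk]
    refine TrivSqZeroExt.ext ?_ ?_
    · rw [T1Lifting.fst_β, hv, fst_inr, map_zero, hg]
    · rw [T1Lifting.snd_β, hv, snd_inr, hd]

/-- **[FantechiManetti1998ObstructionCalculus, THEOREM 7.19] IN THE PRO-REPRESENTABLE CASE** (p. 575: «Let `G` be a
Gdt group functor over a field `k` of characteristic `0`. Then `G` is smooth.» — proof: «By Proposition 7.3 and
Corollary 6.15 it is sufficient to show that `G` has the T¹-lifting property. By Lemma 7.15 this is equivalent to the
surjectivity of `K_G(A_n) → K_G(A_{n−1})` for every `n ≥ 2`; this is an immediate consequence of Lemma 7.18 (ii).»;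
for `G = h_R` PRO-REPRESENTABLE, Lemma 7.18 (ii) is Lemma 7.16 and Cor. 6.15 is Kawamata's theorem, so the
Factorization Theorem 6.2 behind Lemma 7.18 is not needed), with [FantechiManetti1998ObstructionCalculus, EXAMPLE 7.1]
(«If `R` is the local ring at the unit element of a group scheme [Mum, Sect. 11], then `G = h_R` is a group functor
satisfying conditions (H1), (H2), and (H4).»): let `k` be a field of characteristic zero, `R = k[[x_1, …, x_n]]/I` with
`I ⊆ 𝔪²`, and suppose the functor of points `h_R` on `Art_k` carries a group structure for which every `h_R(φ)` is
multiplicative (a group functor of Artin rings whose underlying functor is `h_R`). THEN `I = 0`: `R` IS a formal power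
series ring («`G` is smooth»; [FantechiManetti1998ObstructionCalculus, Lemma 5.6 (i)] «hence `R` is a power series
algebra»). PROOF as printed: Lemma 7.16 (`points_kernel_lifting`) ⇒ the kernels lift ⇒ Lemma 7.15
(`ArtinFunctor.t1Lifting_of_kernel_lifting`) ⇒ T¹-lifting ⇒ `I = 0` by Kawamata's T¹-lifting theorem for `h_R`
(`powerSeries_ideal_eq_bot_of_t1Lifting`, char `0`). The general Gdt group functor (Thm. 7.19 as printed, via
Lemma 7.18 and the Factorization Theorem 6.2) is NOT typed; no group scheme is instantiated.
[cite: FantechiManetti1998ObstructionCalculus, Thm. 7.19 and Example 7.1] -/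
theorem powerSeries_ideal_eq_bot_of_groupFunctor [CharZero k] {n : ℕ} (I : Ideal (MvPowerSeries (Fin n) k))
    (hI : I ≤ (IsLocalRing.maximalIdeal (MvPowerSeries (Fin n) k)) ^ 2)
    [∀ X : ArtAlg.{u} k, Group ((ArtinFunctor.points (k := k) (MvPowerSeries (Fin n) k ⧸ I)).obj X)]
    (hmul : ∀ ⦃X Y : ArtAlg.{u} k⦄ (φ : X →ₐ[k] Y)
      (a b : (ArtinFunctor.points (k := k) (MvPowerSeries (Fin n) k ⧸ I)).obj X),
      (ArtinFunctor.points (k := k) (MvPowerSeries (Fin n) k ⧸ I)).map φ (a * b) =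
        (ArtinFunctor.points (k := k) (MvPowerSeries (Fin n) k ⧸ I)).map φ a *
          (ArtinFunctor.points (k := k) (MvPowerSeries (Fin n) k ⧸ I)).map φ b) :
    I = ⊥ :=
  powerSeries_ideal_eq_bot_of_t1Lifting k I hI
    ((ArtinFunctor.points (k := k) (MvPowerSeries (Fin n) k ⧸ I)).t1Lifting_of_kernel_lifting hmul
      fun m g hg => by
        obtain ⟨g', hg'1, hg'2⟩ := points_kernel_lifting k I hI m g ((points_map_bA_eq_one_iff k I hmul m g).1 hg)
        exact ⟨g', (points_map_bA_eq_one_iff k I hmul (m + 1) g').2 hg'1, hg'2⟩)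

end ProRepresentable

end GroupFunctors

end Literature.AlgebraicGeometry.Deformation
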